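import Mathlib
import Literature.Analysis.FluidPDE.Tao2016AveragedNS.ShiftSetCascadeFlows
import Summits.NavierStokesRegularity.NavierStokesRegularity.Theorems.TaoLadderRungTwoFlatMirrorTableDefs
import Summits.NavierStokesRegularity.NavierStokesRegularity.Theorems.TaoLadderRungTwoFlatQuadPolarOn
import Summits.NavierStokesRegularity.NavierStokesRegularity.Theorems.TaoLadderRungTwoFlatPulseDefs
import Summits.NavierStokesRegularity.NavierStokesRegularity.Theorems.TaoLadderRungTwoFlatLinearisedUniqueness
import Summits.NavierStokesRegularity.NavierStokesRegularity.Theorems.TaoLadderRungTwoFlatLinearisedGronwall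
import HarnessLib

/-!
# Continuous dependence on data for exact global solutions of the homogeneous lattice (any shift set), via
  the MIDPOINT POLARISATION `Q(X) − Q(W) = Lin_{(X+W)/2}(X − W)`
  (helper for item stmt-NavierStokesRegularity-22987 `FlatGapCertificatesV2`, crux K_A♭ of route
  TaoLadderRungTwoFlat; cell harvest/h2-tao-ladder, p1 g19)

Because the field is quadratic, the DIFFERENCE of two exact solutions solves a LINEAR equation exactly:
`d/dt (X − W) = Q(X) − Q(W) = Lin_Ψ(X − W)` with the averaged background `Ψ = (X + W)/2`
(`quadTermOn_sub_eq_linTermOn_mid`). Hence the Gronwall bound of `…LinearisedGronwall` gives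

* `abs_sub_le_mul_exp` — for two exact global solutions at scale ratio `1`, bounded by `M` on `[0, T]`, with
  `|X(0) − W(0)| ≤ B` at every site: `|X_{i,n}(s) − W_{i,n}(s)| ≤ B · exp(2‖α‖₁ M s)` on `[0, T]` — Lipschitz
  dependence on the data in the sup norm over ALL sites (the Lipschitz constant of the hop map of a pulse of
  size `M` over one period `τ` is at most `exp(2‖α‖₁ M τ)`);
* `globalSol_unique` — uniqueness of bounded exact global solutions with the same data;
* `MirrorPulse.isGlobalSol_abs_sub_le` — the corollary for the typed λ₀ = 1 layer.

HONEST FRAMING: elementary real analysis for a MODEL lattice; nothing certified; nothing about the Navier–Stokes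
equations.
-/

noncomputable section

-- the sub-problem namespace repeats the summit name by design (D-0017)
set_option linter.dupNamespace false

namespace Summit.NavierStokesRegularity.NavierStokesRegularity.Theorems

open Set Filter Literature.Analysis.FluidPDE Literature.Analysis.FluidPDE.TaoCascade
open scoped Topology

namespace QuadPolar

variable {m : ℕ}

/-- **Midpoint polarisation**: `Q(X) − Q(W) = Lin_{(X+W)/2}(X − W)` (any shift set, any ratio).
[cite: Tao2016AveragedNS, §4 (4.8)] -/
theorem quadTermOn_sub_eq_linTermOn_mid (𝕊 : Finset (ℤ × ℤ × ℤ)) (ε₀ : ℝ)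
    (α : Fin m → Fin m → Fin m → ℤ × ℤ × ℤ → ℝ) (X W : Fin m → ℤ → ℝ → ℝ) (i : Fin m) (n : ℤ) (t : ℝ) :
    quadTermOn 𝕊 ε₀ α X i n t - quadTermOn 𝕊 ε₀ α W i n t =
      linTermOn 𝕊 ε₀ α ((1 / 2 : ℝ) • (X + W)) (X - W) i n t := by
  have e1 : X - W = X + (-1 : ℝ) • W := by
    funext j k s; simp only [Pi.add_apply, Pi.smul_apply, Pi.sub_apply, smul_eq_mul]; ring
  rw [e1, linTermOn, quadTermOn_eq_bilinOn, quadTermOn_eq_bilinOn]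
  simp only [bilinOn_add_left, bilinOn_add_right, bilinOn_smul_left, bilinOn_smul_right]
  ring

/-- **CONTINUOUS DEPENDENCE ON DATA** (scale ratio `1`, any shift set and table): two exact global solutions
bounded by `M` on `[0, T]` with `|X(0) − W(0)| ≤ B` at every site satisfy
`|X_{i,n}(s) − W_{i,n}(s)| ≤ B·exp(2‖α‖₁ M s)` on `[0, T]`. [cite: Tao2016AveragedNS, §4 (4.8); folklore (Gronwall)] -/
theorem abs_sub_le_mul_exp (𝕊 : Finset (ℤ × ℤ × ℤ)) (α : Fin m → Fin m → Fin m → ℤ × ℤ × ℤ → ℝ)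
    {X W : Fin m → ℤ → ℝ → ℝ} {M B T : ℝ}
    (hX : ∀ i n t, HasDerivAt (X i n) (quadTermOn 𝕊 0 α X i n t) t)
    (hW : ∀ i n t, HasDerivAt (W i n) (quadTermOn 𝕊 0 α W i n t) t)
    (hXb : ∀ i n t, |X i n t| ≤ M) (hWb : ∀ i n t, |W i n t| ≤ M)
    (hB : ∀ i n, |X i n 0 - W i n 0| ≤ B) (i : Fin m) (n : ℤ) {s : ℝ} (hs : s ∈ Icc 0 T) :
    |X i n s - W i n s| ≤ B * Real.exp (2 * tableAbsSum 𝕊 α * M * s) := by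
  set Ψ : Fin m → ℤ → ℝ → ℝ := (1 / 2 : ℝ) • (X + W) with hΨ
  set η : Fin m → ℤ → ℝ → ℝ := X - W with hη
  have hΨc : ∀ j k, Continuous (Ψ j k) := fun j k => by
    have hc : Continuous fun t => (1 / 2 : ℝ) * (X j k t + W j k t) :=
      continuous_const.mul ((continuous_iff_continuousAt.2 fun t => (hX j k t).continuousAt).add
        (continuous_iff_continuousAt.2 fun t => (hW j k t).continuousAt))
    exact hc
  have hΨb : ∀ j k t, |Ψ j k t| ≤ M := fun j k t => by
    show |(1 / 2 : ℝ) * (X j k t + W j k t)| ≤ M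
    rw [abs_mul, abs_of_pos (by norm_num : (0 : ℝ) < 1 / 2)]
    linarith [abs_add_le (X j k t) (W j k t), hXb j k t, hWb j k t]
  have hder : ∀ j k t, HasDerivAt (η j k) (linTermOn 𝕊 0 α Ψ η j k t) t := fun j k t => by
    rw [hΨ, hη, ← quadTermOn_sub_eq_linTermOn_mid]
    exact (hX j k t).sub (hW j k t)
  have hηb : ∀ j k, ∀ t ∈ Icc 0 T, |η j k t| ≤ 2 * M := fun j k t _ => by
    show |X j k t - W j k t| ≤ 2 * M
    linarith [abs_sub (X j k t) (W j k t), hXb j k t, hWb j k t]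
  have h := abs_le_mul_exp 𝕊 α hΨc hΨb hder hηb hB i n hs
  exact h

/-- **Uniqueness of bounded exact global solutions** with the same data (scale ratio `1`).
[cite: Tao2016AveragedNS, §4 (4.8); folklore (Gronwall)] -/
theorem globalSol_unique (𝕊 : Finset (ℤ × ℤ × ℤ)) (α : Fin m → Fin m → Fin m → ℤ × ℤ × ℤ → ℝ)
    {X W : Fin m → ℤ → ℝ → ℝ} {M T : ℝ}
    (hX : ∀ i n t, HasDerivAt (X i n) (quadTermOn 𝕊 0 α X i n t) t)
    (hW : ∀ i n t, HasDerivAt (W i n) (quadTermOn 𝕊 0 α W i n t) t)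
    (hXb : ∀ i n t, |X i n t| ≤ M) (hWb : ∀ i n t, |W i n t| ≤ M) (h0 : ∀ i n, X i n 0 = W i n 0)
    (i : Fin m) (n : ℤ) {s : ℝ} (hs : s ∈ Icc 0 T) : X i n s = W i n s := by
  have h := abs_sub_le_mul_exp 𝕊 α (B := 0) hX hW hXb hWb (fun j k => by simp [h0 j k]) i n hs
  rw [zero_mul] at h
  have := abs_nonpos_iff.mp h
  linarith

end QuadPolar

namespace MirrorPulse

/-- **Lipschitz dependence of the λ₀ = 1 mirror lattice on its data**: two bounded global solutions
(`IsGlobalSol ε`, `|·| ≤ M`) with `|X(0) − W(0)| ≤ B` satisfy `|X − W|(s) ≤ B·exp(2‖T♭‖₁ M s)` for `s ≥ 0`.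
[cite: Tao2016AveragedNS, §4 (4.8); route TaoLadderRungTwoFlat, λ₀ = 1 layer] -/
theorem isGlobalSol_abs_sub_le {ε : ℝ} {X W : Fin 2 → ℤ → ℝ → ℝ} {M B : ℝ} (hX : IsGlobalSol ε X)
    (hW : IsGlobalSol ε W) (hXb : ∀ i n t, |X i n t| ≤ M) (hWb : ∀ i n t, |W i n t| ≤ M)
    (hB : ∀ i n, |X i n 0 - W i n 0| ≤ B) (i : Fin 2) (n : ℤ) {s : ℝ} (hs : 0 ≤ s) :
    |X i n s - W i n s| ≤ B * Real.exp (2 * QuadPolar.tableAbsSum shiftSetFlat (mirrorTable ε ε) * M * s) :=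
  QuadPolar.abs_sub_le_mul_exp shiftSetFlat (mirrorTable ε ε) (T := s) hX hW hXb hWb hB i n ⟨hs, le_rfl⟩

/-- Bounded global solutions of the λ₀ = 1 mirror lattice are determined by their data (forward in time).
[cite: Tao2016AveragedNS, §4 (4.8); route TaoLadderRungTwoFlat, λ₀ = 1 layer] -/
theorem isGlobalSol_unique {ε : ℝ} {X W : Fin 2 → ℤ → ℝ → ℝ} (hX : IsGlobalSol ε X) (hW : IsGlobalSol ε W)
    (hXb : IsBddFam X) (hWb : IsBddFam W) (h0 : ∀ i n, X i n 0 = W i n 0) (i : Fin 2) (n : ℤ) {s : ℝ}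
    (hs : 0 ≤ s) : X i n s = W i n s := by
  obtain ⟨MX, hMX⟩ := hXb
  obtain ⟨MW, hMW⟩ := hWb
  exact QuadPolar.globalSol_unique shiftSetFlat (mirrorTable ε ε) (M := max MX MW) (T := s) hX hW
    (fun i n t => (hMX i n t).trans (le_max_left _ _)) (fun i n t => (hMW i n t).trans (le_max_right _ _))
    h0 i n ⟨hs, le_rfl⟩

end MirrorPulse

end Summit.NavierStokesRegularity.NavierStokesRegularity.Theorems

end
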